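import Literature.NumberTheory.Transcendental.EllipticPeriodLogSpan
import Literature.NumberTheory.Transcendental.PhilipponZeroEstimateOneFactor
import Literature.NumberTheory.Transcendental.PhilipponZeroEstimateOneFactorProofs
import HarnessLib

/-!
# A non-zero elliptic period is not in the `ℚ̄`-span of `1` and logarithms — discharge

Discharge of the named fact `Literature.NumberTheory.Transcendental.ellipticPeriod_not_mem_logSpan`
(`EllipticPeriodLogSpan.lean`; Huber–Wüstholz 2022 Thm. 15.3 (1) / Baker–Wüstholz 2007 §6 for the
1-motive `[ℤ^r → 𝔾ₘ^r] × [0 → E]`, complex multiplication allowed).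

Everything was already in the tree except the last input: `EllipticPeriodLogSpanProofs.lean` and
`SemistabilityOneFactor.lean` reduce the fact to Philippon's zero estimate (1986, Thm. 2.1) on
`M_κ = 𝔾ₘ^β × P_κ` with at most one elliptic factor, CM allowed
(`ellipticPeriod_not_mem_logSpan_holds_of : philippon1986_oneFactor → ellipticPeriod_not_mem_logSpan`,
file `PhilipponZeroEstimateOneFactor.lean`), and that zero estimate is now proved
(`philippon1986_oneFactor_holds`, file `PhilipponZeroEstimateOneFactorProofs.lean`: Roy's zero
estimate for the theta model on the unconditional hard data).

## References
* [HuberWustholz2022] A. Huber, G. Wüstholz, *Transcendence and linear relations of 1-periods*,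
  Cambridge Tracts 227 (2022), Thm. 15.3 (1) with Thm. 6.2.
* [BakerWustholz2007] A. Baker, G. Wüstholz, *Logarithmic Forms and Diophantine Geometry*
  (2007), Thm. 6.1, Thm. 6.15, §6.8.
* [Philippon1986] P. Philippon, Bull. Soc. Math. France 114 (1986), Thm. 2.1.
-/

namespace Literature.NumberTheory.Transcendental

/-- **A non-zero period of an elliptic curve over `ℚ̄` is not of the form
`β₀ + Σ βᵢ log αᵢ` with algebraic `βᵢ`, `αᵢ`** — the named fact `ellipticPeriod_not_mem_logSpan`
holds (CM allowed): the tree's reduction to Philippon's one-factor zero estimate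
(`ellipticPeriod_not_mem_logSpan_holds_of`) applied to `philippon1986_oneFactor_holds`.
[cite: HuberWustholz2022, Thm. 15.3 (1) with Thm. 6.2] [cite: BakerWustholz2007, Thm. 6.1, Thm. 6.15, §6.8] [cite: Philippon1986, Thm 2.1] -/
theorem ellipticPeriod_not_mem_logSpan_holds : ellipticPeriod_not_mem_logSpan :=
  ellipticPeriod_not_mem_logSpan_holds_of philippon1986_oneFactor_holds

end Literature.NumberTheory.Transcendental
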